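import Summits.HodgeConjecture.HodgeConjecture.Theorems.F0P3RoutingOfCot
import Summits.HodgeConjecture.HodgeConjecture.Theorems.F0P3XiSideOfRecordSCD
import Summits.HodgeConjecture.HodgeConjecture.Theorems.F0P3CohClassRoutingCot
import HarnessLib

/-!
# (J2)-SCD — law #15 `Routing` (★ V8 text, GUARDED) AT `𝔠₀` OVER THE SC ξ-SIDE OF RECORD `xiSideOfRecordSCD` (F0P3-p04 (g10); R4-SCD twin of ★ `F0P3RoutingOfCot` — DATA-typed partner, REF1 R-43 «SC-CHOOSE»)

Cell `hodgecm-mathlib`, F0∕P3 «U3-mult», crux H413 (`stmt-HodgeConjecture-24833`).  THE SCD TWIN (supercuspidal partner as DATA, a subtype-valued function — REF1 R-43 ∕ F0P2-p01 (g9) cert 4ee1e2e4: the Prop-∃ + `choose` variant lost the [13.1.4] pin by proof irrelevance) of ★ `Theorems/F0P3RoutingOfCot.lean` (namespace `…F0T2RoutingKitOfRecordOfCot`),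
TOKEN FOR TOKEN, for the closer's ED. 19b branch (α) «Q-CMᵀ chain» (desk F0P3-plan (g8) RULING D19 (2) + ADDENDUM (A); LEAD F0P3a-plan (g9) T8-21 (A) R4 ∕ T8-23 (A)): the
junk-vulnerable character-identity binder `hCM` (concluding ★ `CMNonsplitCharIdentityAt`, ∀ over ALL bare functions — F0P3b-plan (g11) 2026-09-01T02:18:06Z, REF1 R-42) is
replaced by the SUPERCUSPIDAL PARTNER DATUM `hSC` (F0P3a-p01 (g11) R4-SC census 4d81fd43 (v3)∕(q7): K0 reads only `.πs`), and every K0 token by its ★ SC twin: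
`xiPacketFamilyOfRecord[_of_split∕_of_nonsplit] ↦ …SC` (★ A1ᴰ), `xiEvpOfRecord[_apply] ↦ xiEvpOfRecordSCD[_apply]` (★ A2ᴰ), `xiSideOfRecord ↦ xiSideOfRecordSCD`
(★ B1ᴰ); the explicit telescope loses `Δ mH mG νG νH ξloc` (they entered only through `hCM`'s type).  Heads: `clFinChoice_eq_πn_of_routesOffSCD`, `eqOff_of_routesOffSCD`,
`eqOff_rep_cl_of_routesOffSCD`, `routing₈_kitOfRecordSCD_of_cot` (the closer's `Rung0Choice.rows` row #15 under (α)), `routing₈_kitOfRecordSCD_of_cohClassRouting`.  Proofs = ★'s.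
PROOF lane shape: theorems only, no `def`, NO instance declaration or attribute (the GK-module telescope of the guarded letter is referenced through the ★ def `F0P3CohClassRoutingCot.CohClassRoutingCot`, not re-spelled), no notation, no `sorry`; `--supports stmt-HodgeConjecture-24833`.
HONEST LABEL: HC_CM is proved only modulo the printed citations until rung 0 closes; this file moves no letter.
-/

set_option autoImplicit false
set_option linter.dupNamespace false

noncomputable section

open NumberField IsDedekindDomain MeasureTheory
open Literature.NumberTheory.Rogawski1990 Literature.NumberTheory.GaloisRepresentations
open Literature.NumberTheory.Automorphic Literature.NumberTheory.Automorphic.UnitaryGroup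
open Literature.RepresentationTheory.BorelWallach2000 Literature.RepresentationTheory.KonnoKonno2007
open scoped Matrix Classical

namespace Summit.HodgeConjecture.HodgeConjecture.Cruxes.H413.F0T2RoutingKitOfRecordOfCotSCD

open Summit.HodgeConjecture.HodgeConjecture.Cruxes.H413.F0P3InnerFormClassificationV6
open Summit.HodgeConjecture.HodgeConjecture.Cruxes.H413.F0P3KitOfRecord (kitOfRecord XiSide GHSide)
open Summit.HodgeConjecture.HodgeConjecture.Cruxes.H413.F0P3ClassTokensOfRecord (Cls cl rep)
open Summit.HodgeConjecture.HodgeConjecture.Cruxes.H413.F0P3ClassTokenChoice (clFinChoice evpChoice admUnitConstituents)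
open Summit.HodgeConjecture.HodgeConjecture.Cruxes.H413.F0P3XiPacketFamilyOfRecord
open Summit.HodgeConjecture.HodgeConjecture.Cruxes.H413.F0P3XiPacketFamilyOfRecordSCD
open Summit.HodgeConjecture.HodgeConjecture.Cruxes.H413.F0P3XiSideOfRecordSCD (xiSideOfRecordSCD)
open Summit.HodgeConjecture.HodgeConjecture.Cruxes.H413.F0P3LettersRouting (CohClassRouting evpChoice_rep_cl routing_kitOfRecord)
open Summit.HodgeConjecture.HodgeConjecture.Cruxes.H413.F0P3CohClassRoutingCot (CohClassRoutingCot RoutesAt)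

variable (L : Type) [Field L] [NumberField L] [IsCMField L] (H : Matrix (Fin 3) (Fin 3) L)

variable (hH : (H.map (cmConjRingHom L))ᵀ = H) (hHd : IsUnit H.det) (μω : HeckeCharacter L) (hμu : μω.IsUnitary)
  [∀ v : HeightOneSpectrum (𝓞 ↥(maximalRealSubfield L)), MeasurableSpace (Gqs L v ⧸ Subgroup.center (Gqs L v))]
  (μZ : ∀ v : HeightOneSpectrum (𝓞 ↥(maximalRealSubfield L)), Measure (Gqs L v ⧸ Subgroup.center (Gqs L v)))
  (keys : ∀ (ξ : OneDimAutRepH L) (v : HeightOneSpectrum (𝓞 ↥(maximalRealSubfield L))),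
    (∀ w : PlacesOver L v, IsCMField.complexConj L • w.1 = w.1) →
      {p : IrrClass (Gqs L v) × IrrClass (Gqs L v) //
        KeysCaseTwoLabels L v (μω.semilocalComponent L v) (torusLocalComponent L (IsCMField.complexConj L) v ξ.η)
          (torusLocalComponent L (IsCMField.complexConj L) v ξ.ψ) p.1 p.2 ∧
        p.1.IsSquareIntegrable (μZ v) ∧ ¬ p.2.IsSquareIntegrable (μZ v)})
  (ι : L →+* ℂ) (T : GL (Fin 3) ℂ)
  (hT : (T : Matrix (Fin 3) (Fin 3) ℂ)ᴴ * H.map ι * (T : Matrix (Fin 3) (Fin 3) ℂ) = Literature.Geometry.ComplexHyperbolic.BallModel.J)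
  (μ : Measure (Gp L H).automorphicQuotient) [(Gp L H).IsAutomorphicMeasure μ]

/-! ## §1 The ★ chain re-threaded PER `P` over the SC record: from the routing conclusion at `(P, ξ, S₁)` to the e.v.p. form at `rep (cl P)` -/

section EvpForm

variable
  (hSC : letI : ∀ v : HeightOneSpectrum (𝓞 ↥(maximalRealSubfield L)), MeasurableSpace ((cmDatum L 3 H).Local v) := fun _ => borel _
    ∀ (ξ : OneDimAutRepH L) (v : HeightOneSpectrum (𝓞 ↥(maximalRealSubfield L)))
    (hns : ∀ w : PlacesOver L v, IsCMField.complexConj L • w.1 = w.1)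
    (T : GL (Fin 3) (LocalRing L v)) (a : LocalRing L v) (ha : IsUnit a)
    (h : formCongr (conjLocal L (IsCMField.complexConj L) v) T (H.map (algebraMap L (LocalRing L v))) =
      a • (Matrix.of fun i j : Fin 3 => if i.val + j.val + 1 = 3 then (1 : L) else 0).map (algebraMap L (LocalRing L v)))
    (π2 πn : IrrClass (Gqs L v)),
    KeysCaseTwoLabels L v (μω.semilocalComponent L v) (torusLocalComponent L (IsCMField.complexConj L) v ξ.η)
      (torusLocalComponent L (IsCMField.complexConj L) v ξ.ψ) π2 πn → ¬ πn.IsSquareIntegrable (μZ v) →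
    {πs : IrrClass ((cmDatum L 3 H).Local v) // πs.IsSupercuspidal ∧ πs ≠ IrrClass.comap (cmDatumLocalCongr L v T ha h).symm πn})
  (hexc : ∀ ξ : OneDimAutRepH L, ∀ᶠ v : HeightOneSpectrum (𝓞 ↥(maximalRealSubfield L)) in Filter.cofinite,
      ∀ hns : ∀ w : PlacesOver L v, IsCMField.complexConj L • w.1 = w.1,
        ((keys ξ v hns).1.2).IsSpherical (cmLocalIntegralLevel L 3 (qsForm L) v))
  (μv : ∀ v : Places L, @Measure ((cmDatum L 3 H).Local v) (borel _))

/-- **Routing to the SC packet OF RECORD off `S₁ ∪ ram₀ ξ`, PER `P`** (SC twin of ★ `clFinChoice_eq_πn_of_routesOff`: ★ `clFinChoice_eq_πn_of_cohClassRouting` with the letter replaced by its conclusion at `(P, ξ, S₁)`):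
`clFinChoice P v = (xiPacketFamilyOfRecordSCD … ξ v).πn` for `v ∉ S₁ ∪ ramOfRecord₂ … ξ (hexc ξ)`. [cite: Rogawski1990, §13.1 p. 199; §12.2 (2) pp. 173–174] -/
theorem clFinChoice_eq_πn_of_routesOffSCD (P : DiscreteAutomorphicRep (Gp L H) μ) (ξ : OneDimAutRepH L) (S₁ : Finset (Places L))
    (hS : ∀ v : Places L, v ∉ S₁ →
      (∀ hs : ∃ w : PlacesOver L v, IsCMField.complexConj L • w.1 ≠ w.1,
          clFinChoice P v =
            (cmSplitPacket L H hH hHd v (splitWitness v hs) (splitWitness_spec v hs) (ξ.splitν₀ μω (splitWitness v hs).1)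
              (ξ.locψ (splitWitness v hs).1) (ξ.norm_splitν₀_apply hμu (splitWitness v hs).1)
              (ξ.continuous_splitν₀ μω (splitWitness v hs).1) (ξ.norm_locψ_apply (splitWitness v hs).1)
              (ξ.continuous_locψ (splitWitness v hs).1)).πn) ∧
      (∀ hns : ∀ w : PlacesOver L v, IsCMField.complexConj L • w.1 = w.1,
        ∀ (T : GL (Fin 3) (LocalRing L v)) (a : LocalRing L v) (ha : IsUnit a)
          (h : formCongr (conjLocal L (IsCMField.complexConj L) v) T (H.map (algebraMap L (LocalRing L v))) =
            a • (Matrix.of fun i j : Fin 3 => if i.val + j.val + 1 = 3 then (1 : L) else 0).map (algebraMap L (LocalRing L v))),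
          (∀ g : (cmDatum L 3 H).Local v, (cmDatumLocalCongr L v T ha h).symm g ∈ cmLocalIntegralLevel L 3 (qsForm L) v ↔
            g ∈ cmLocalIntegralLevel L 3 H v) →
          clFinChoice P v = IrrClass.comap (cmDatumLocalCongr L v T ha h).symm (keys ξ v hns).1.2)) :
    letI : ∀ v : HeightOneSpectrum (𝓞 ↥(maximalRealSubfield L)), MeasurableSpace ((cmDatum L 3 H).Local v) := fun _ => borel _
    ∀ v : Places L, v ∉ S₁ ∪ ramOfRecord₂ L H hH hHd μω μZ keys ξ (hexc ξ) →
      clFinChoice P v = (xiPacketFamilyOfRecordSCD L H hH hHd μω hμu μZ keys hSC ξ v).πn := by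
  letI : ∀ v : HeightOneSpectrum (𝓞 ↥(maximalRealSubfield L)), MeasurableSpace ((cmDatum L 3 H).Local v) := fun _ => borel _
  intro v hv
  rw [Finset.mem_union, not_or] at hv
  by_cases hs : ∃ w : PlacesOver L v, IsCMField.complexConj L • w.1 ≠ w.1
  · rw [xiPacketFamilyOfRecordSCD_of_split L H hH hHd μω hμu μZ keys hSC ξ v hs]
    exact (hS v hv.1).1 hs
  · have hns : ∀ w : PlacesOver L v, IsCMField.complexConj L • w.1 = w.1 := fun w => not_not.1 fun hw => hs ⟨w, hw⟩
    obtain ⟨T', a, ha, hT', hP, hlev⟩ := xiPacketFamilyOfRecordSCD_of_nonsplit L H hH hHd μω hμu μZ keys hSC ξ v hns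
    have hgood := good_of_not_mem_ramOfRecord₂ L H hH hHd μω μZ keys ξ hv.2
    rw [hP]
    exact (hS v hv.1).2 hns T' a ha hT' (hlev (hgood.2 hns).1)

include hexc in
/-- **The e.v.p. form at `P`, PER `P`** (SC twin of ★ `eqOff_of_routesOff`): `EqOff (S₁ ∪ ram₀ ξ) (evpChoice P · (μv ·)) (xiEvpOfRecordSCD … μv ξ)`.
[cite: Rogawski1990, §15.3 ¶1 p. 244; §13.7 p. 206] [cite: CartierCorvallis1979, §IV.1 Cor. 4.1] -/
theorem eqOff_of_routesOffSCD (P : DiscreteAutomorphicRep (Gp L H) μ) (ξ : OneDimAutRepH L) (S₁ : Finset (Places L))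
    (hS : ∀ v : Places L, v ∉ S₁ →
      (∀ hs : ∃ w : PlacesOver L v, IsCMField.complexConj L • w.1 ≠ w.1,
          clFinChoice P v =
            (cmSplitPacket L H hH hHd v (splitWitness v hs) (splitWitness_spec v hs) (ξ.splitν₀ μω (splitWitness v hs).1)
              (ξ.locψ (splitWitness v hs).1) (ξ.norm_splitν₀_apply hμu (splitWitness v hs).1)
              (ξ.continuous_splitν₀ μω (splitWitness v hs).1) (ξ.norm_locψ_apply (splitWitness v hs).1)
              (ξ.continuous_locψ (splitWitness v hs).1)).πn) ∧
      (∀ hns : ∀ w : PlacesOver L v, IsCMField.complexConj L • w.1 = w.1,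
        ∀ (T : GL (Fin 3) (LocalRing L v)) (a : LocalRing L v) (ha : IsUnit a)
          (h : formCongr (conjLocal L (IsCMField.complexConj L) v) T (H.map (algebraMap L (LocalRing L v))) =
            a • (Matrix.of fun i j : Fin 3 => if i.val + j.val + 1 = 3 then (1 : L) else 0).map (algebraMap L (LocalRing L v))),
          (∀ g : (cmDatum L 3 H).Local v, (cmDatumLocalCongr L v T ha h).symm g ∈ cmLocalIntegralLevel L 3 (qsForm L) v ↔
            g ∈ cmLocalIntegralLevel L 3 H v) →
          clFinChoice P v = IrrClass.comap (cmDatumLocalCongr L v T ha h).symm (keys ξ v hns).1.2)) :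
    letI : ∀ v : HeightOneSpectrum (𝓞 ↥(maximalRealSubfield L)), MeasurableSpace ((cmDatum L 3 H).Local v) := fun _ => borel _
    EqOff L H (S₁ ∪ ramOfRecord₂ L H hH hHd μω μZ keys ξ (hexc ξ)) (fun v => evpChoice P v (μv v))
      (xiEvpOfRecordSCD L H hH hHd μω hμu μZ keys hSC μv ξ) := by
  letI : ∀ v : HeightOneSpectrum (𝓞 ↥(maximalRealSubfield L)), MeasurableSpace ((cmDatum L 3 H).Local v) := fun _ => borel _
  intro v hv
  show evpChoice P v (μv v) = xiEvpOfRecordSCD L H hH hHd μω hμu μZ keys hSC μv ξ v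
  rw [xiEvpOfRecordSCD_apply]
  unfold evpChoice
  rw [clFinChoice_eq_πn_of_routesOffSCD L H hH hHd μω hμu μZ keys μ hSC hexc P ξ S₁ hS v hv]

include hexc in
/-- **The same at the representative `rep (cl P)`** (SC twin of ★ `eqOff_rep_cl_of_routesOff`; the shape the kit law reads: `EqOff S (evp (cl P)) (tXi ξ)`).
[cite: Rogawski1990, §15.3 ¶1 p. 244] [cite: Dixmier1977, §13.1.3] -/
theorem eqOff_rep_cl_of_routesOffSCD (P : DiscreteAutomorphicRep (Gp L H) μ) (ξ : OneDimAutRepH L) (S₁ : Finset (Places L))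
    (hS : ∀ v : Places L, v ∉ S₁ →
      (∀ hs : ∃ w : PlacesOver L v, IsCMField.complexConj L • w.1 ≠ w.1,
          clFinChoice P v =
            (cmSplitPacket L H hH hHd v (splitWitness v hs) (splitWitness_spec v hs) (ξ.splitν₀ μω (splitWitness v hs).1)
              (ξ.locψ (splitWitness v hs).1) (ξ.norm_splitν₀_apply hμu (splitWitness v hs).1)
              (ξ.continuous_splitν₀ μω (splitWitness v hs).1) (ξ.norm_locψ_apply (splitWitness v hs).1)
              (ξ.continuous_locψ (splitWitness v hs).1)).πn) ∧
      (∀ hns : ∀ w : PlacesOver L v, IsCMField.complexConj L • w.1 = w.1,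
        ∀ (T : GL (Fin 3) (LocalRing L v)) (a : LocalRing L v) (ha : IsUnit a)
          (h : formCongr (conjLocal L (IsCMField.complexConj L) v) T (H.map (algebraMap L (LocalRing L v))) =
            a • (Matrix.of fun i j : Fin 3 => if i.val + j.val + 1 = 3 then (1 : L) else 0).map (algebraMap L (LocalRing L v))),
          (∀ g : (cmDatum L 3 H).Local v, (cmDatumLocalCongr L v T ha h).symm g ∈ cmLocalIntegralLevel L 3 (qsForm L) v ↔
            g ∈ cmLocalIntegralLevel L 3 H v) →
          clFinChoice P v = IrrClass.comap (cmDatumLocalCongr L v T ha h).symm (keys ξ v hns).1.2)) :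
    letI : ∀ v : HeightOneSpectrum (𝓞 ↥(maximalRealSubfield L)), MeasurableSpace ((cmDatum L 3 H).Local v) := fun _ => borel _
    EqOff L H (S₁ ∪ ramOfRecord₂ L H hH hHd μω μZ keys ξ (hexc ξ)) (fun v => evpChoice (rep (Gp L H) μ (cl (Gp L H) μ P)) v (μv v))
      (xiEvpOfRecordSCD L H hH hHd μω hμu μZ keys hSC μv ξ) := by
  letI : ∀ v : HeightOneSpectrum (𝓞 ↥(maximalRealSubfield L)), MeasurableSpace ((cmDatum L 3 H).Local v) := fun _ => borel _
  intro v hv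
  exact (evpChoice_rep_cl P v (μv v)).trans (eqOff_of_routesOffSCD L H hH hHd μω hμu μZ keys μ hSC hexc μv P ξ S₁ hS v hv)

end EvpForm

/-! ## §2 GLUE (SC): the GUARDED law `Routing` (★ V8 text) AT the SC `𝔠₀` from the GUARDED letter, and from the unguarded letter -/

section Glue

variable
  (hSC : letI : ∀ v : HeightOneSpectrum (𝓞 ↥(maximalRealSubfield L)), MeasurableSpace ((cmDatum L 3 H).Local v) := fun _ => borel _
    ∀ (ξ : OneDimAutRepH L) (v : HeightOneSpectrum (𝓞 ↥(maximalRealSubfield L)))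
    (hns : ∀ w : PlacesOver L v, IsCMField.complexConj L • w.1 = w.1)
    (T : GL (Fin 3) (LocalRing L v)) (a : LocalRing L v) (ha : IsUnit a)
    (h : formCongr (conjLocal L (IsCMField.complexConj L) v) T (H.map (algebraMap L (LocalRing L v))) =
      a • (Matrix.of fun i j : Fin 3 => if i.val + j.val + 1 = 3 then (1 : L) else 0).map (algebraMap L (LocalRing L v)))
    (π2 πn : IrrClass (Gqs L v)),
    KeysCaseTwoLabels L v (μω.semilocalComponent L v) (torusLocalComponent L (IsCMField.complexConj L) v ξ.η)
      (torusLocalComponent L (IsCMField.complexConj L) v ξ.ψ) π2 πn → ¬ πn.IsSquareIntegrable (μZ v) →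
    {πs : IrrClass ((cmDatum L 3 H).Local v) // πs.IsSupercuspidal ∧ πs ≠ IrrClass.comap (cmDatumLocalCongr L v T ha h).symm πn})
  (hexc : ∀ ξ : OneDimAutRepH L, ∀ᶠ v : HeightOneSpectrum (𝓞 ↥(maximalRealSubfield L)) in Filter.cofinite,
      ∀ hns : ∀ w : PlacesOver L v, IsCMField.complexConj L • w.1 = w.1,
        ((keys ξ v hns).1.2).IsSpherical (cmLocalIntegralLevel L 3 (qsForm L) v))
  (μv : ∀ v : Places L, @Measure ((cmDatum L 3 H).Local v) (borel _))
  [MeasurableSpace (Gp L H).Adelic] [BorelSpace (Gp L H).Adelic]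
  (𝔰 : Sockets L H μ) (gh : GHSide L H ι T hT 𝔰.PacketG 𝔰.PacketH)
  (evpG' : 𝔰.PacketG → EvpData L H) (evpH' : 𝔰.PacketH → EvpData L H) (ramG' : 𝔰.PacketG → Finset (Places L)) (ramH' : 𝔰.PacketH → Finset (Places L))
  (PiXi' : OneDimAutRepH L → 𝔰.PacketG) (ρXi' : OneDimAutRepH L → 𝔰.PacketH)
  (c : ℚ) (jInf dsInf : ℤ → ℤ → ℤ → Cinf)
  (archTr : Cinf → (UnitaryGroup.arch (↥(maximalRealSubfield L)) L (IsCMField.complexConj L) 3 H → ℂ) → ℂ)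
  (ν : Measure (Gp L H).Adelic) [IsFiniteMeasureOnCompacts ν]
  (ramCls₀ : DiscreteAutomorphicRep (Gp L H) μ → Set (Places L))

/-- **(J2)-SC Row #15 — the GUARDED law `Routing` (★ V8 text `IsCot P → KcTrivial P → …`) AT `𝔠₀ = kitOfRecord … (xiSideOfRecordSCD …)` FROM THE GUARDED LETTER** (SC twin of ★ `routing₈_kitOfRecord_of_cot`) BY ★ NAME `F0P3CohClassRoutingCot.CohClassRoutingCot L H hH hHd μω hμu μZ keys ι T hT μ` (p830755; = `∀ P, IsCot … P → ‹body of ★ CohClassRouting at P›` with the two clauses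
abbreviated ★ `RoutesAt`, definitionally — the closer's `stub_L3 …` instance at the frame IS this Prop, so the junction is `apply …; exact stub_L3 …`).  The kit reads `evp (cl P) v = evpChoice (rep (cl P)) v (μv v)` and `tXi = xiEvpOfRecordSCD … μv` (`rfl`, ★ `xiSideOfRecordSC_tXi`).
[cite: Rogawski1990, §15.3 ¶1 p. 244; §13.3 Thm. 13.3.6 (c) p. 202] -/
theorem routing₈_kitOfRecordSCD_of_cot (h : CohClassRoutingCot L H hH hHd μω hμu μZ keys ι T hT μ) :
    F0P3InnerFormClassificationV8.ClassificationKit.Routing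
      (kitOfRecord L H ι T hT μ 𝔰 gh
        (xiSideOfRecordSCD L H hH hHd μω hμu μZ keys hSC hexc μv evpG' evpH' ramG' ramH' PiXi' ρXi')
        μω c jInf dsInf archTr ν μv ramCls₀) := by
  intro P hP _ M _ _ σK σ𝔤 hM hirr htok δ hδ hne
  letI : ∀ v : HeightOneSpectrum (𝓞 ↥(maximalRealSubfield L)), MeasurableSpace ((cmDatum L 3 H).Local v) := fun _ => borel _
  obtain ⟨ξ, S₁, hS⟩ := h P hP M σK σ𝔤 hM hirr htok δ hδ hne
  exact ⟨ξ, S₁ ∪ ramOfRecord₂ L H hH hHd μω μZ keys ξ (hexc ξ),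
    eqOff_rep_cl_of_routesOffSCD L H hH hHd μω hμu μZ keys μ hSC hexc μv P ξ S₁ hS⟩

/-- **Compatibility** (SC twin of ★ `routing₈_kitOfRecord_of_cohClassRouting`): the UNGUARDED letter ★ `CohClassRouting` feeds the guarded V8 law at the SC `𝔠₀` too (a fortiori).
[cite: Rogawski1990, §15.3 ¶1 p. 244] -/
theorem routing₈_kitOfRecordSCD_of_cohClassRouting (h : CohClassRouting L H hH hHd μω hμu μZ keys ι T hT μ) :
    F0P3InnerFormClassificationV8.ClassificationKit.Routing
      (kitOfRecord L H ι T hT μ 𝔰 gh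
        (xiSideOfRecordSCD L H hH hHd μω hμu μZ keys hSC hexc μv evpG' evpH' ramG' ramH' PiXi' ρXi')
        μω c jInf dsInf archTr ν μv ramCls₀) :=
  routing₈_kitOfRecordSCD_of_cot L H hH hHd μω hμu μZ keys ι T hT μ hSC hexc μv 𝔰 gh evpG' evpH' ramG' ramH' PiXi' ρXi' c jInf dsInf
    archTr ν ramCls₀ (F0P3CohClassRoutingCot.cohClassRoutingCot_of_cohClassRouting L H hH hHd μω hμu μZ keys ι T hT μ h)

end Glue

end Summit.HodgeConjecture.HodgeConjecture.Cruxes.H413.F0T2RoutingKitOfRecordOfCotSCD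

end
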